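import Literature.AnabelianGeometry.AbsoluteAnabelian.AutHolomorphicSpacesProofs
import Literature.AnabelianGeometry.AbsoluteAnabelian.AutHolomorphicSpacesTransportProofs
import HarnessLib

/-!
# Inclusions of open subsets are morphisms of Aut-holomorphic spaces

PROOF-ONLY companion (no new definitions, no new named facts) of `AutHolomorphicSpaces.lean`
([AbsTopIII] Def. 2.1 (i)/(ii), S. Mochizuki, *Topics in absolute anabelian geometry III*, §2,
kurims pp. 50–51).  abc-iut cell, seat abc-iut-w5-d053 (sub-DAG [AbsTopIII] Cor 2.7 (b), row
Cor-27.b.r10 (b).8).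

For a space `M` charted over `ℂ` and opens `V₁ ≤ V₂` of `M`:

* `mdifferentiableAt_opens_opens_iff` — for `W : Opens ↥V` (an open of an open) a self-map
  `f : W → W` is `ℂ`-differentiable at `x` iff the ambient self-map of `M` extending it (by the
  identity) is, at the underlying point (two applications of the tree's `mdifferentiableAt_opens_iff`);
* `mdifferentiable_homeoConj_iff_of_inclusion` — conjugating a self-homeomorphism of an open
  `W ⊆ V₁` by a homeomorphism `W ≃ₜ W'` onto an open `W' ⊆ V₂` THAT IS THE IDENTITY ON UNDERLYING
  POINTS does not change holomorphy;
* `isMorphism_ofCharted_inclusion` — **the inclusion `↥V₁ → ↥V₂` is a morphism of the associated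
  Aut-holomorphic spaces** `(V₁, Aut^hol) → (V₂, Aut^hol)` (Def. 2.1 (ii));
* `IsMorphism.of_inclusion_comp` — cancellation: a local homeomorphism `e : X → ↥V₁` whose
  composite with the inclusion is a morphism `(X, A) → (V₂, Aut^hol)` is a morphism
  `(X, A) → (V₁, Aut^hol)`.

Refereed pre-IUT material (definitions only are involved); nothing here bears on the disputed
[IUTchIII] Cor. 3.12; no side taken.
-/

noncomputable section

namespace Literature.AnabelianGeometry.AbsoluteAnabelian

universe u

open _root_.TopologicalSpace _root_.Topology _root_.Set _root_.Function _root_.Filter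
open scoped _root_.Manifold _root_.ContDiff

variable {M : Type u} [TopologicalSpace M] [ChartedSpace ℂ M]

/-! ### Self-maps of opens of opens -/

/-- A self-map `f` of an open `W` of an open `V` of `M` is `ℂ`-differentiable at `x` iff the ambient
self-map of `M` that extends `f` by the identity is `ℂ`-differentiable at the underlying point.
[cite: MochizukiAbsTopIII2015, Definition 2.1 (i) p.50] -/
theorem mdifferentiableAt_opens_opens_iff {V : Opens M} {W : Opens ↥V} (f : W → W) (x : W) :
    MDifferentiableAt 𝓘(ℂ, ℂ) 𝓘(ℂ, ℂ) f x ↔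
      MDifferentiableAt 𝓘(ℂ, ℂ) 𝓘(ℂ, ℂ)
        (Function.extend (fun y : W => ((y : ↥V) : M)) (fun y => ((f y : ↥V) : M)) id)
        ((x : ↥V) : M) := by
  -- injectivity of the double coercion
  have hinj : Function.Injective (fun y : W => ((y : ↥V) : M)) := fun y y' h =>
    Subtype.ext (Subtype.ext h)
  have hinj₁ : Function.Injective (fun y : W => (y : ↥V)) := fun y y' h => Subtype.ext h
  -- the intermediate extension to `↥V`
  set F₁ : ↥V → ↥V := Function.extend (fun y : W => (y : ↥V)) (fun y => (f y : ↥V)) id with hF₁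
  set F : M → M := Function.extend (fun y : W => ((y : ↥V) : M)) (fun y => ((f y : ↥V) : M)) id
    with hF
  have hfF₁ : ∀ y : W, (f y : ↥V) = F₁ y := fun y => by
    rw [hF₁, hinj₁.extend_apply]
  have hF₁F : ∀ v : ↥V, ((F₁ v : ↥V) : M) = F v := by
    intro v
    by_cases hv : ∃ y : W, (y : ↥V) = v
    · obtain ⟨y, rfl⟩ := hv
      rw [hF₁, hF, hinj₁.extend_apply, hinj.extend_apply]
    · have hv' : ¬ ∃ y : W, ((y : ↥V) : M) = (v : M) := by
        rintro ⟨y, hy⟩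
        exact hv ⟨y, Subtype.ext hy⟩
      rw [hF₁, hF, Function.extend_apply' _ _ _ hv, Function.extend_apply' _ _ _ hv']
      rfl
  rw [mdifferentiableAt_opens_iff (U := W) (V := W) (Φ := F₁) (Ψ := f) hfF₁ x,
    mdifferentiableAt_opens_iff (U := V) (V := V) (Φ := F) (Ψ := F₁) hF₁F (x : ↥V)]

/-- **Conjugation along a point-preserving homeomorphism of opens preserves holomorphy.**  For opens
`W ⊆ V₁`, `W' ⊆ V₂` of `M` and a homeomorphism `ε : W ≃ₜ W'` with `ε x = x` on underlying points of
`M`, a self-map `f` of `W` is `ℂ`-differentiable everywhere iff `ε ∘ f ∘ ε⁻¹` is.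
[cite: MochizukiAbsTopIII2015, Definition 2.1 (ii) p.51] -/
theorem mdifferentiable_homeoConj_iff_of_inclusion {V₁ V₂ : Opens M} {W : Opens ↥V₁}
    {W' : Opens ↥V₂} (ε : W ≃ₜ W') (hε : ∀ x : W, (((ε x : W') : ↥V₂) : M) = ((x : ↥V₁) : M))
    (f : W → W) :
    MDifferentiable 𝓘(ℂ, ℂ) 𝓘(ℂ, ℂ) f ↔
      MDifferentiable 𝓘(ℂ, ℂ) 𝓘(ℂ, ℂ) (fun y : W' => ε (f (ε.symm y))) := by
  have hε' : ∀ y : W', (((ε.symm y : W) : ↥V₁) : M) = ((y : ↥V₂) : M) := fun y => by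
    rw [← hε (ε.symm y), ε.apply_symm_apply]
  -- both sides have the SAME ambient extension
  have hinj : Function.Injective (fun y : W => ((y : ↥V₁) : M)) := fun y y' h =>
    Subtype.ext (Subtype.ext h)
  have hinj' : Function.Injective (fun y : W' => ((y : ↥V₂) : M)) := fun y y' h =>
    Subtype.ext (Subtype.ext h)
  have hext : Function.extend (fun y : W' => ((y : ↥V₂) : M))
        (fun y => (((ε (f (ε.symm y)) : W') : ↥V₂) : M)) id =
      Function.extend (fun y : W => ((y : ↥V₁) : M)) (fun y => ((f y : ↥V₁) : M)) id := by
    funext m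
    by_cases hm : ∃ y : W, ((y : ↥V₁) : M) = m
    · obtain ⟨y, rfl⟩ := hm
      have h1 : ((((ε y) : W') : ↥V₂) : M) = ((y : ↥V₁) : M) := hε y
      rw [hinj.extend_apply]
      conv_lhs => rw [← h1]
      rw [hinj'.extend_apply, ε.symm_apply_apply, hε]
    · have hm' : ¬ ∃ y : W', ((y : ↥V₂) : M) = m := by
        rintro ⟨y, hy⟩
        exact hm ⟨ε.symm y, by rw [hε', hy]⟩
      rw [Function.extend_apply' _ _ _ hm, Function.extend_apply' _ _ _ hm']
  constructor
  · intro h y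
    rw [mdifferentiableAt_opens_opens_iff, hext, ← hε' y]
    exact (mdifferentiableAt_opens_opens_iff f (ε.symm y)).1 (h _)
  · intro h x
    rw [mdifferentiableAt_opens_opens_iff, ← hext, ← hε x]
    exact (mdifferentiableAt_opens_opens_iff _ (ε x)).1 (h _)

/-- Transport of `Aut^hol` along a point-preserving homeomorphism between an open of `V₁` and an
open of `V₂`: `Aut^hol(W) ↦ Aut^hol(W')`. [cite: MochizukiAbsTopIII2015, Definition 2.1 (ii) p.51] -/
theorem holAut_map_homeoConj_of_inclusion {V₁ V₂ : Opens M} {W : Opens ↥V₁} {W' : Opens ↥V₂}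
    (ε : W ≃ₜ W') (hε : ∀ x : W, (((ε x : W') : ↥V₂) : M) = ((x : ↥V₁) : M)) :
    (holAut W).map (homeoConj ε).toMonoidHom = holAut W' := by
  ext ψ'
  constructor
  · rintro ⟨ψ, ⟨h₁, h₂⟩, rfl⟩
    refine ⟨?_, ?_⟩
    · exact (mdifferentiable_homeoConj_iff_of_inclusion ε hε ψ).1 h₁
    · exact (mdifferentiable_homeoConj_iff_of_inclusion ε hε ψ.symm).1 h₂
  · rintro ⟨h₁, h₂⟩
    refine ⟨(homeoConj ε).symm ψ', ⟨?_, ?_⟩, (homeoConj ε).apply_symm_apply ψ'⟩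
    · have hfun : (fun y : W' => ε (((homeoConj ε).symm ψ') (ε.symm y))) = ⇑ψ' := by
        funext y
        change ε (ε.symm (ψ' (ε (ε.symm y)))) = ψ' y
        rw [ε.apply_symm_apply, ε.apply_symm_apply]
      refine (mdifferentiable_homeoConj_iff_of_inclusion ε hε _).2 ?_
      rw [hfun]
      exact h₁
    · have hfun : (fun y : W' => ε ((((homeoConj ε).symm ψ').symm) (ε.symm y))) = ⇑ψ'.symm := by
        funext y
        change ε (ε.symm (ψ'.symm (ε (ε.symm y)))) = ψ'.symm y
        rw [ε.apply_symm_apply, ε.apply_symm_apply]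
      refine (mdifferentiable_homeoConj_iff_of_inclusion ε hε _).2 ?_
      rw [hfun]
      exact h₂

/-! ### The inclusion of opens is a morphism -/

/-- **The inclusion `V₁ ↪ V₂` of opens of a space charted over `ℂ` is a morphism of the associated
Aut-holomorphic spaces** (Def. 2.1 (ii)): it is a local homeomorphism, and on a connected open
`W ⊆ V₁` mapped (identically) onto `W' ⊆ V₂` it carries `Aut^hol(W)` onto `Aut^hol(W')`.
[cite: MochizukiAbsTopIII2015, Definition 2.1 (ii) p.51] -/
theorem isMorphism_ofCharted_inclusion {V₁ V₂ : Opens M} (hle : V₁ ≤ V₂) :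
    IsMorphism (AutHolStructure.ofCharted ↥V₁) (AutHolStructure.ofCharted ↥V₂)
      (fun x : ↥V₁ => (⟨(x : M), hle x.2⟩ : ↥V₂)) where
  isLocalHomeomorph :=
    (TopologicalSpace.Opens.isOpenEmbedding_of_le hle).isLocalHomeomorph
  map_aut_eq _ _ _ _ ε hε :=
    holAut_map_homeoConj_of_inclusion ε fun x => congrArg (fun v : ↥V₂ => (v : M)) (hε x)

/-- **Cancellation of an inclusion of opens**: if `e : X → ↥V₁` is a local homeomorphism and the
composite `X → ↥V₁ ↪ ↥V₂` is a morphism `(X, A) → (V₂, Aut^hol)`, then `e` is a morphism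
`(X, A) → (V₁, Aut^hol)`. [cite: MochizukiAbsTopIII2015, Definition 2.1 (ii) p.51] -/
theorem IsMorphism.of_inclusion_comp {X : Type u} [TopologicalSpace X] {A : AutHolStructure X}
    {V₁ V₂ : Opens M} (hle : V₁ ≤ V₂) {e : X → ↥V₁} (he : IsLocalHomeomorph e)
    (h : IsMorphism A (AutHolStructure.ofCharted ↥V₂)
      ((fun x : ↥V₁ => (⟨(x : M), hle x.2⟩ : ↥V₂)) ∘ e)) :
    IsMorphism A (AutHolStructure.ofCharted ↥V₁) e := by
  refine ⟨he, ?_⟩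
  intro U W _ _ ε hε
  -- the image `W₀ ⊆ V₂` of `W` under the inclusion, and the canonical `κ : W ≃ₜ W₀`
  set j : ↥V₁ → ↥V₂ := fun x : ↥V₁ => (⟨(x : M), hle x.2⟩ : ↥V₂) with hj
  have hjo : IsOpenEmbedding j := TopologicalSpace.Opens.isOpenEmbedding_of_le hle
  let W₀ : ConnectedOpens ↥V₂ :=
    ⟨⟨j '' (W.1 : Set ↥V₁), hjo.isOpenMap _ W.1.isOpen⟩, W.2.image j hjo.continuous.continuousOn⟩
  have hmaps : ∀ x, x ∈ (W.1 : Set ↥V₁) → j x ∈ (W₀.1 : Set ↥V₂) := fun x hx => ⟨x, hx, rfl⟩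
  let κf : W.1 → W₀.1 := Subtype.map j hmaps
  have hκ_inj : Function.Injective κf := fun x x' hxx =>
    Subtype.ext (hjo.injective (congrArg Subtype.val hxx))
  have hκ_surj : Function.Surjective κf := by
    rintro ⟨y, x, hx, rfl⟩
    exact ⟨⟨x, hx⟩, rfl⟩
  let κ : W.1 ≃ₜ W₀.1 :=
    (Equiv.ofBijective κf ⟨hκ_inj, hκ_surj⟩).toHomeomorphOfContinuousOpen
      (hjo.continuous.subtype_map hmaps) (hjo.isOpenMap.subtype_map W.1.isOpen hmaps)
  have hκ : ∀ x : W.1, (((κ x : W₀.1) : ↥V₂) : M) = ((x : ↥V₁) : M) := fun x => rfl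
  have hκ' : ∀ x : W.1, ((κ x : W₀.1) : ↥V₂) = j x := fun x => rfl
  -- transport along `κ` and along `ε ≫ κ`
  have h1 : (holAut W.1).map (homeoConj κ).toMonoidHom = holAut W₀.1 :=
    holAut_map_homeoConj_of_inclusion κ hκ
  have h2 : (A.aut U).map (homeoConj (ε.trans κ)).toMonoidHom = holAut W₀.1 := by
    refine h.map_aut_eq U W₀ U.2 W₀.2 (ε.trans κ) fun x => ?_
    change j ((ε x : W.1) : ↥V₁) = j (e x)
    rw [hε x]
  rw [homeoConj_trans, ← Subgroup.map_map, ← h1] at h2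
  exact Subgroup.map_injective (homeoConj κ).injective h2

end Literature.AnabelianGeometry.AbsoluteAnabelian
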